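import Summits.QuantumFields.YangMills.Theorems.BalabanUVNodesN15PerCubeGreenTwoGridGradientNamedReg335HolderSmall
import Summits.QuantumFields.YangMills.Theorems.BalabanUVNodesN15PerCubeGreenTwoGridKnitDefectReg335HolderRate
import HarnessLib

/-!
# N15 = NE2, road (c) — PROGRAMME (PC), (PC-E-J-N) 392J: ★★★★ THE (PC-E) RATE FOR THE GRADIENT ENTRY `D_U∘G′(U)` OF [B9] (3.42) FOR THE NAMED SCALAR COVARIANT GREEN's FUNCTIONS —
# n15-c∕392 with `D∘` in front, on top of n15-c∕419: from ONE `Reg335HolderCube` ∕ `B11Reg910Classes.Reg910Cube` datum per cube ([B11] Thm 1 (9)–(10) AS TYPED) and ONE smallness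
# condition, the two-grid η-defect THROUGH `τ_{Ad∘U′}` of `D_{U′,μ₀}∘(Δ_{R_U′} + a′Q′_TᵀQ′_T)⁻¹` against `D_{U,μ₀}∘(Δ_{R_U} + aQ′_TᵀQ′_T)⁻¹` (`U` = straight fine holonomies) is
# `≤ D(1+κ_e|m|(R₁+R₂))·((L^k)^{−1∕4} + (2L^{−k})^{β})·e^{−(δ∕16)|y−y′|_T}`, UNIFORMLY IN THE FINE SPACING, NO existential over gauges (dag-n15-c g36, n15-c∕420)

Cell `pub-ymgap`, seat `pub-ymgap-dag-n15-c` (generation g36; R134 (a) seat, strategy s1 «first missing estimate»; HUMAN RULING D-0062; chair R424 venue).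
`bears_on: R4∕N15 · K3⁸ SpineGivenEndpointR13SepCoPHV (stmt-QuantumFields-27366)`; filed `--kind proof --supports stmt-QuantumFields-27366 --as helper` — COUNT-NEUTRAL.
TWO theorems, 0 `def`, 0 `sorry`: `uN_idef_covD_scGreenOp_of_reg335Holder_rate` ∕ ★★★★ `uN_idef_covD_scGreenOp_of_reg910_rate` = n15-c∕392's two theorems with (i) the parent
replaced by n15-c∕419 `uN_idef_covD_scGreenOp_of_reg335Holder_small_explicit` (direction `μ₀`), (ii) the conclusions stated for `D_{U′,μ₀} ∘ scGreenOp′ … U′` against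
`D_{U,μ₀} ∘ scGreenOp … U` (n15-c∕388); the proofs are 392's VERBATIM (real algebra on the majorant: n15-c∕374 `divergenceFitHolder_bookkeeping` BY NAME; dag-n07-a
`Reg910Cube.reg335HolderCube` for the printed class).  Imports BY NAME n15-c∕419, n15-c∕374; generator `tools/build_420.py`; nothing in the tree is modified, no landed name re-declared.

HONEST FRAMING ∕ LIMITS.  Bookkeeping over landed theorems (real algebra on the majorant only); MODEL two-grid setting (King tori, straight-holonomy pairing, one cube scale `ξ`); the
datum is the typed per-cube class ([B11] Thm 1 (9)–(10) as typed by dag-n07-a) as a HYPOTHESIS; nothing of [B9]∕[B11] asserted.  The SHAPE of the gradient entry of [B9] (3.42) ∕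
Thm 3.14 for `G′`, NOT the printed theorem.  NE2⁺ NOT PRINTED ∕ NOT proved; N15 of record untouched (DISCHARGED AS CONSUMED, p687738); K3⁸ OPEN; counts of record UNMOVED (typed
28∕28 · discharged 8∕27); one finite 𝕋⁴ at fixed ε per index — NOT infinite volume, NOT OS on ℝ⁴, NOT a mass gap, NOT Clay.  Restate-immune (no Theses import).
-/



set_option autoImplicit false

noncomputable section

open scoped BigOperators Matrix Matrix.Norms.L2Operator
open Finset

namespace Summit.QuantumFields.YangMills.BalabanUVNodes.N15.Gluing

open Real
open Literature.MathematicalPhysics.QuantumFieldTheory.Balaban1983to89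
open Literature.MathematicalPhysics.QuantumFieldTheory.Balaban1983to89.B5Prop11Plancherel (Tor fine unitVec)
open Literature.MathematicalPhysics.QuantumFieldTheory.Balaban1983to89.B11SectG (BlockNorm HasMaj)
open Literature.MathematicalPhysics.QuantumFieldTheory.Balaban1983to89.T4EtaRateDefect (idef)
open Literature.MathematicalPhysics.QuantumFieldTheory.Balaban1983to89.B6UnitTorusCarrier (unitTorusGeo)
open Summit.QuantumFields.YangMills.BalabanUVNodes.N15.CurvedSpecies (Reg335HolderCube)
open Literature.MathematicalPhysics.QuantumFieldTheory.King1986 (aK)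
open Literature.MathematicalPhysics.QuantumFieldTheory.King1986.Torus (tdistT)
open Literature.Barriers.QuantumFields (traceForm)
open Summit.QuantumFields.YangMills.BalabanUVNodes.N15.VectorPiece (kingPr)
open Summit.QuantumFields.YangMills.BalabanUVNodes.N15.MatrixSpecies (coordMat basisConst basisConst_nonneg liftBlk liftMap covD)
open Summit.QuantumFields.YangMills.BalabanUVNodes.N15.CovAvg (mprod kingSec ctauS)

variable {d : ℕ}

/-! ## §1 (the real bookkeeping lemma `divergenceFitHolder_bookkeeping` is n15-c∕374's, imported BY NAME) -/

/-! ## §2 The rate, uniform in the fine spacing -/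

section Rate

variable {L : ℕ} [NeZero L]

set_option maxHeartbeats 800000 in
/-- ★★★ **THE (PC-E-H) RATE FOR THE GRADIENT ENTRY `D_U∘G′(U)` OF THE NAMED GREEN's FUNCTIONS ON `Reg335HolderCube`** — n15-c∕392 with `D∘` in front, NO `∃ u′`.  See the module docstring.
[cite: Balaban1985BackgroundPropagators, (3.42) p.397, Thm 3.14 pp.426–427 (template), (3.24)–(3.25) p.394, (3.35) p.396, (3.51)–(3.52) p.400 (shapes); Balaban1985Variational, Thm 1 (9) p.279 (the Hölder clause: shape); King1986, p.664 (pairing), Lemma 4.5 (4.38) p.674 (A = 0 template)] -/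
theorem uN_idef_covD_scGreenOp_of_reg335Holder_rate (hL : Odd L ∧ 1 < L) (hL7 : 7 ≤ L) {a₀ : ℝ} (ha₀ : 0 < a₀) (ι : Type) [Fintype ι] [DecidableEq ι] (μ₀ : Fin (d + 1)) :
    ∃ δ w₀ c₀ D : ℝ, 0 < δ ∧ 0 < c₀ ∧ 0 ≤ D ∧ ∀ (mv kk r : ℕ), 1 ≤ kk → 1 ≤ r → w₀ ≤ ((L ^ mv : ℕ) : ℝ) →
      ∀ {mm : Type} [Fintype mm] [DecidableEq mm] [Nonempty mm] (e : Matrix mm mm ℂ ≃L[ℝ] (ι → ℝ)), (∀ A B : Matrix mm mm ℂ, traceForm A B = e A ⬝ᵥ e B) →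
      ∀ (U' : Fin (d + 1) → ScX' d L mv kk r hL → (Matrix mm mm ℂ)ˣ), (∀ μ x', (U' μ x' : Matrix mm mm ℂ) ∈ Matrix.unitaryGroup mm ℂ) →
      ∀ (Q : (Fin (d + 1) → ZMod (2 * L)) → Set (ScX' d L mv kk r hL)) (ξ C β Cβ : ℝ), 0 < ξ → 0 ≤ C → 0 ≤ β → 0 ≤ Cβ →
        (1 + @basisConst ι _ (Matrix mm mm ℂ) Matrix.frobeniusNormedAddCommGroup Matrix.frobeniusNormedSpace e * (2 * Real.sqrt (Fintype.card mm)) * Real.sqrt (Fintype.card mm)) ^ 2 * (C / ξ + C / ξ ^ 2) ≤ c₀ →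
        (∀ k, Reg335HolderCube (scShift' d L mv kk r hL) U' ((((L ^ r * L ^ kk : ℕ) : ℝ))⁻¹) (Q k) ξ (fun z z' => ((((L ^ r * L ^ kk : ℕ) : ℝ))⁻¹) * tdistT (fine (L ^ r * L ^ kk) (cvM d L mv kk hL)) z z') C β Cβ) →
        (∀ k z, (∃ y ∈ cvSk d L mv kk hL k, (unitTorusGeo L kk (cvM d L mv kk hL)).dist (scBlk' d L mv kk r hL z) y ≤ 5) → z ∈ Q k) →
        HasMaj (ScNorm d L mv kk hL ι) (BlockNorm.ofBlocks (unitTorusGeo L kk (cvM d L mv kk hL)) (liftBlk (scBlk d L mv kk hL ∘ kingPr L kk r (cvM d L mv kk hL)) ι))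
          (idef (ctauS (cvM d L mv kk hL) L kk r (fun μ x' => coordMat e (ContinuousLinearMap.mulLeftRight ℝ (Matrix mm mm ℂ) ((U' μ x' : Matrix mm mm ℂ)) ((U' μ x' : Matrix mm mm ℂ))ᴴ))) (ctauS (cvM d L mv kk hL) L kk r (fun μ x' => coordMat e (ContinuousLinearMap.mulLeftRight ℝ (Matrix mm mm ℂ) ((U' μ x' : Matrix mm mm ℂ)) ((U' μ x' : Matrix mm mm ℂ))ᴴ))) (covD ((((L ^ r * L ^ kk : ℕ) : ℝ))⁻¹) (fun x' => coordMat e (ContinuousLinearMap.mulLeftRight ℝ (Matrix mm mm ℂ) ((U' μ₀ x' : Matrix mm mm ℂ)) ((U' μ₀ x' : Matrix mm mm ℂ))ᴴ)) (scShift' d L mv kk r hL μ₀) ∘ₗ scGreenOp' d L mv kk r hL (aK a₀ (L : ℝ) (r + kk) * (((L ^ r * L ^ kk : ℕ) : ℝ)) ^ (d + 1)) ((((L ^ r * L ^ kk : ℕ) : ℝ))⁻¹) ι e (fun μ z => (U' μ z : Matrix mm mm ℂ))) (covD ((((L ^ kk : ℕ) : ℝ))⁻¹) (fun x => coordMat e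 (ContinuousLinearMap.mulLeftRight ℝ (Matrix mm mm ℂ) ((fun μ y => mprod (fun t => (U' μ (kingSec (cvM d L mv kk hL) L kk r y + t • unitVec (fine (L ^ r * L ^ kk) (cvM d L mv kk hL)) μ) : Matrix mm mm ℂ)) (L ^ r)) μ₀ x) ((fun μ y => mprod (fun t => (U' μ (kingSec (cvM d L mv kk hL) L kk r y + t • unitVec (fine (L ^ r * L ^ kk) (cvM d L mv kk hL)) μ) : Matrix mm mm ℂ)) (L ^ r)) μ₀ x)ᴴ)) (scShift d L mv kk hL μ₀) ∘ₗ scGreenOp d L mv kk hL (aK a₀ (L : ℝ) kk * (((L ^ kk : ℕ) : ℝ)) ^ (d + 1)) ((((L ^ kk : ℕ) : ℝ))⁻¹) ι e (fun μ y => mprod (fun t => (U' μ (kingSec (cvM d L mv kk hL) L kk r y + t • unitVec (fine (L ^ r * L ^ kk) (cvM d L mv kk hL)) μ) : Matrix mm mm ℂ)) (L ^ r))))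
          (fun y y' => D * (1 + @basisConst ι _ (Matrix mm mm ℂ) Matrix.frobeniusNormedAddCommGroup Matrix.frobeniusNormedSpace e * Fintype.card mm * ((4 * Cβ * (ξ ^ (2 + β))⁻¹ * Real.exp (5 * (C / ξ))) + ((2 * ((d + 1 : ℕ) : ℝ) + 2) * ((C / ξ ^ 2) ^ 2 * Real.exp (2 * (C / ξ))) + 8 * ((C / ξ) * (C / ξ ^ 2) * Real.exp (2 * (C / ξ))) + 8 * ((C / ξ) * (C / ξ ^ 2) * Real.exp (5 * (C / ξ)))))) * (((L : ℝ) ^ kk) ^ (-(1 / 4 : ℝ)) + (2 * ((((L ^ kk : ℕ) : ℝ))⁻¹)) ^ β) * Real.exp (-(δ / 16 * (unitTorusGeo L kk (cvM d L mv kk hL)).dist y y'))) := by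
  obtain ⟨δ, w₀, c₀, D, hδ, hc₀, H⟩ := uN_idef_covD_scGreenOp_of_reg335Holder_small_explicit (d := d) hL hL7 ha₀ ι μ₀
  have hLpos : 0 < L := (by have := hL.2; omega)
  have hL1r : (1 : ℝ) < (L : ℝ) := by exact_mod_cast hL.2
  refine ⟨δ, w₀, c₀, max D 0, hδ, hc₀, le_max_right _ _, fun mv kk r hk hr hw₀ => ?_⟩
  intro mm _ _ _ e he U' hU'g Q ξ C β Cβ hξ hC hβ hCβ hsmall h335 hQ
  have hmain := H mv kk r hk hr hw₀ e he U' hU'g Q ξ C β Cβ hξ hC hβ hCβ hsmall h335 hQ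
  refine hmain.mono fun y y' => ?_
  have hκ := @basisConst_nonneg ι _ (Matrix mm mm ℂ) Matrix.frobeniusNormedAddCommGroup Matrix.frobeniusNormedSpace e
  have hx1 : (1 : ℝ) ≤ (L : ℝ) ^ kk := one_le_pow₀ hL1r.le
  have hηx : ((((L ^ kk : ℕ) : ℝ))⁻¹) ≤ ((L : ℝ) ^ kk) ^ (-(1 / 4 : ℝ)) := by rw [Nat.cast_pow]; exact (inv_le_rpow_neg_quarter hx1).1
  have hx0 : (0 : ℝ) ≤ ((L : ℝ) ^ kk) ^ (-(1 / 4 : ℝ)) := by positivity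
  have hxβ0 : (0 : ℝ) ≤ (2 * ((((L ^ kk : ℕ) : ℝ))⁻¹)) ^ β := Real.rpow_nonneg (by positivity) β
  have hoB := divergenceFitHolder_bookkeeping (@basisConst ι _ (Matrix mm mm ℂ) Matrix.frobeniusNormedAddCommGroup Matrix.frobeniusNormedSpace e) (Fintype.card mm : ℝ) ((d + 1 : ℕ) : ℝ) ((L ^ r : ℕ) : ℝ) ((L ^ r - 1 : ℕ) : ℝ) ((L ^ kk : ℕ) : ℝ) ((L ^ r * L ^ kk : ℕ) : ℝ)
    ((((L ^ kk : ℕ) : ℝ))⁻¹) ((((L ^ r * L ^ kk : ℕ) : ℝ))⁻¹) ((C / ξ) * Real.exp (((((L ^ r * L ^ kk : ℕ) : ℝ))⁻¹) * (C / ξ))) ((C / ξ ^ 2) * Real.exp (((((L ^ r * L ^ kk : ℕ) : ℝ))⁻¹) * (C / ξ))) ((Cβ * (ξ ^ (2 + β))⁻¹ * (2 * ((L ^ r : ℕ) : ℝ) * ((((L ^ r * L ^ kk : ℕ) : ℝ))⁻¹)) ^ β + 2 * ((((L ^ r * L ^ kk : ℕ) : ℝ))⁻¹) * ((C / ξ)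 * (C / ξ ^ 2))) * Real.exp (5 * (((((L ^ r * L ^ kk : ℕ) : ℝ))⁻¹) * (C / ξ)))) C Cβ ξ β hκ (Nat.cast_nonneg _) (Nat.cast_nonneg _)
    (by exact_mod_cast Nat.one_le_pow _ _ hLpos) (by exact_mod_cast Nat.sub_le _ _) (by exact_mod_cast Nat.one_le_pow _ _ hLpos) (by rw [Nat.cast_mul]) rfl rfl hξ hC hCβ rfl rfl rfl
  have hR0 : (0 : ℝ) ≤ (4 * Cβ * (ξ ^ (2 + β))⁻¹ * Real.exp (5 * (C / ξ))) + ((2 * ((d + 1 : ℕ) : ℝ) + 2) * ((C / ξ ^ 2) ^ 2 * Real.exp (2 * (C / ξ))) + 8 * ((C / ξ) * (C / ξ ^ 2) * Real.exp (2 * (C / ξ))) + 8 * ((C / ξ) * (C / ξ ^ 2) * Real.exp (5 * (C / ξ)))) := by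
    have : (0 : ℝ) < ξ ^ (2 + β) := Real.rpow_pos_of_pos hξ _
    positivity
  have hoB0 : (0 : ℝ) ≤ (@basisConst ι _ (Matrix mm mm ℂ) Matrix.frobeniusNormedAddCommGroup Matrix.frobeniusNormedSpace e * (((L ^ r * L ^ kk : ℕ) : ℝ) ^ 2 * (Fintype.card mm * (2 * (((((L ^ r * L ^ kk : ℕ) : ℝ))⁻¹) ^ 2 * ((Cβ * (ξ ^ (2 + β))⁻¹ * (2 * ((L ^ r : ℕ) : ℝ) * ((((L ^ r * L ^ kk : ℕ) : ℝ))⁻¹)) ^ β + 2 * ((((L ^ r * L ^ kk : ℕ) : ℝ))⁻¹) * ((C / ξ) * (C / ξ ^ 2))) * Real.exp (5 * (((((L ^ r * L ^ kk : ℕ) : ℝ))⁻¹) * (C / ξ))))) + ((((L ^ r * L ^ kk : ℕ) : ℝ))⁻¹) ^ 2 * ((C / ξ ^ 2) * Real.exp (((((L ^ r * L ^ kk : ℕ) : ℝ))⁻¹) * (C / ξ))) * (((d + 1 : ℕ) : ℝ) * (((L ^ r - 1 : ℕ) : ℝ) * (((((L ^ r * L ^ kk : ℕ) : ℝ))⁻¹)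 ^ 2 * ((C / ξ ^ 2) * Real.exp (((((L ^ r * L ^ kk : ℕ) : ℝ))⁻¹) * (C / ξ)))))) + (((((L ^ r * L ^ kk : ℕ) : ℝ))⁻¹) ^ 2 * ((C / ξ ^ 2) * Real.exp (((((L ^ r * L ^ kk : ℕ) : ℝ))⁻¹) * (C / ξ))) + (((d + 1 : ℕ) : ℝ) * (((L ^ r - 1 : ℕ) : ℝ) * (((((L ^ r * L ^ kk : ℕ) : ℝ))⁻¹) ^ 2 * ((C / ξ ^ 2) * Real.exp (((((L ^ r * L ^ kk : ℕ) : ℝ))⁻¹) * (C / ξ)))))) + ((((L ^ r * L ^ kk : ℕ) : ℝ))⁻¹) ^ 2 * ((C / ξ ^ 2) * Real.exp (((((L ^ r * L ^ kk : ℕ) : ℝ))⁻¹) * (C / ξ)))) * (((((L ^ r * L ^ kk : ℕ) : ℝ))⁻¹) ^ 2 * ((C / ξ ^ 2) * Real.exp (((((L ^ r * L ^ kk : ℕ) : ℝ))⁻¹) * (C / ξ)))))) + Fintype.card mm * (2 * ((L ^ kk : ℕ) : ℝ) ^ 2 * (2 * ((L ^ r : ℕ) : ℝ) ^ 3 * ((((((L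 ^ r * L ^ kk : ℕ) : ℝ))⁻¹) * ((C / ξ) * Real.exp (((((L ^ r * L ^ kk : ℕ) : ℝ))⁻¹) * (C / ξ)))) * (((((L ^ r * L ^ kk : ℕ) : ℝ))⁻¹) ^ 2 * ((C / ξ ^ 2) * Real.exp (((((L ^ r * L ^ kk : ℕ) : ℝ))⁻¹) * (C / ξ))))) + ((L ^ r : ℕ) : ℝ) ^ 2 * (((((L ^ r * L ^ kk : ℕ) : ℝ))⁻¹) ^ 2 * ((Cβ * (ξ ^ (2 + β))⁻¹ * (2 * ((L ^ r : ℕ) : ℝ) * ((((L ^ r * L ^ kk : ℕ) : ℝ))⁻¹)) ^ β + 2 * ((((L ^ r * L ^ kk : ℕ) : ℝ))⁻¹) * ((C / ξ) * (C / ξ ^ 2))) * Real.exp (5 * (((((L ^ r * L ^ kk : ℕ) : ℝ))⁻¹) * (C / ξ)))))) + 2 * (((L ^ r : ℕ) : ℝ) * ((L ^ kk : ℕ) : ℝ)) ^ 2 * ((((L ^ r : ℕ) : ℝ) + 1) * (((((L ^ r * L ^ kk : ℕ) : ℝ))⁻¹) * ((C / ξ) * Real.exp (((((L ^ r * L ^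 kk : ℕ) : ℝ))⁻¹) * (C / ξ)))) * (((((L ^ r * L ^ kk : ℕ) : ℝ))⁻¹) ^ 2 * ((C / ξ ^ 2) * Real.exp (((((L ^ r * L ^ kk : ℕ) : ℝ))⁻¹) * (C / ξ)))))))) := by
    have : (0 : ℝ) ≤ (2 * ((L ^ r : ℕ) : ℝ) * ((((L ^ r * L ^ kk : ℕ) : ℝ))⁻¹)) ^ β := Real.rpow_nonneg (by positivity) β
    have : (0 : ℝ) < ξ ^ (2 + β) := Real.rpow_pos_of_pos hξ _
    positivity
  -- `κ|m|((2η)^β R₁ + η R₂) ≤ κ|m|(R₁ + R₂)·(x14 + (2η)^β)`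
  have hR10 : (0 : ℝ) ≤ (4 * Cβ * (ξ ^ (2 + β))⁻¹ * Real.exp (5 * (C / ξ))) := by have : (0 : ℝ) < ξ ^ (2 + β) := Real.rpow_pos_of_pos hξ _; positivity
  have hR20 : (0 : ℝ) ≤ ((2 * ((d + 1 : ℕ) : ℝ) + 2) * ((C / ξ ^ 2) ^ 2 * Real.exp (2 * (C / ξ))) + 8 * ((C / ξ) * (C / ξ ^ 2) * Real.exp (2 * (C / ξ))) + 8 * ((C / ξ) * (C / ξ ^ 2) * Real.exp (5 * (C / ξ)))) := by positivity
  have h2 : (@basisConst ι _ (Matrix mm mm ℂ) Matrix.frobeniusNormedAddCommGroup Matrix.frobeniusNormedSpace e * (((L ^ r * L ^ kk : ℕ) : ℝ) ^ 2 * (Fintype.card mm * (2 * (((((L ^ r * L ^ kk : ℕ) : ℝ))⁻¹) ^ 2 * ((Cβ * (ξ ^ (2 + β))⁻¹ * (2 * ((L ^ r : ℕ) : ℝ) * ((((L ^ r * L ^ kk : ℕ) : ℝ))⁻¹)) ^ β + 2 * ((((L ^ r * L ^ kk : ℕ) : ℝ))⁻¹) * ((C / ξ) * (C / ξ ^ 2)))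 * Real.exp (5 * (((((L ^ r * L ^ kk : ℕ) : ℝ))⁻¹) * (C / ξ))))) + ((((L ^ r * L ^ kk : ℕ) : ℝ))⁻¹) ^ 2 * ((C / ξ ^ 2) * Real.exp (((((L ^ r * L ^ kk : ℕ) : ℝ))⁻¹) * (C / ξ))) * (((d + 1 : ℕ) : ℝ) * (((L ^ r - 1 : ℕ) : ℝ) * (((((L ^ r * L ^ kk : ℕ) : ℝ))⁻¹) ^ 2 * ((C / ξ ^ 2) * Real.exp (((((L ^ r * L ^ kk : ℕ) : ℝ))⁻¹) * (C / ξ)))))) + (((((L ^ r * L ^ kk : ℕ) : ℝ))⁻¹) ^ 2 * ((C / ξ ^ 2) * Real.exp (((((L ^ r * L ^ kk : ℕ) : ℝ))⁻¹) * (C / ξ))) + (((d + 1 : ℕ) : ℝ) * (((L ^ r - 1 : ℕ) : ℝ) * (((((L ^ r * L ^ kk : ℕ) : ℝ))⁻¹) ^ 2 * ((C / ξ ^ 2) * Real.exp (((((L ^ r * L ^ kk : ℕ) : ℝ))⁻¹) * (C / ξ)))))) + ((((L ^ r * L ^ kk : ℕ) : ℝ))⁻¹) ^ 2 * ((C / ξ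 ^ 2) * Real.exp (((((L ^ r * L ^ kk : ℕ) : ℝ))⁻¹) * (C / ξ)))) * (((((L ^ r * L ^ kk : ℕ) : ℝ))⁻¹) ^ 2 * ((C / ξ ^ 2) * Real.exp (((((L ^ r * L ^ kk : ℕ) : ℝ))⁻¹) * (C / ξ)))))) + Fintype.card mm * (2 * ((L ^ kk : ℕ) : ℝ) ^ 2 * (2 * ((L ^ r : ℕ) : ℝ) ^ 3 * ((((((L ^ r * L ^ kk : ℕ) : ℝ))⁻¹) * ((C / ξ) * Real.exp (((((L ^ r * L ^ kk : ℕ) : ℝ))⁻¹) * (C / ξ)))) * (((((L ^ r * L ^ kk : ℕ) : ℝ))⁻¹) ^ 2 * ((C / ξ ^ 2) * Real.exp (((((L ^ r * L ^ kk : ℕ) : ℝ))⁻¹) * (C / ξ))))) + ((L ^ r : ℕ) : ℝ) ^ 2 * (((((L ^ r * L ^ kk : ℕ) : ℝ))⁻¹) ^ 2 * ((Cβ * (ξ ^ (2 + β))⁻¹ * (2 * ((L ^ r : ℕ) : ℝ) * ((((L ^ r * L ^ kk : ℕ) : ℝ))⁻¹)) ^ β + 2 * ((((L ^ r * L ^ kk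 : ℕ) : ℝ))⁻¹) * ((C / ξ) * (C / ξ ^ 2))) * Real.exp (5 * (((((L ^ r * L ^ kk : ℕ) : ℝ))⁻¹) * (C / ξ)))))) + 2 * (((L ^ r : ℕ) : ℝ) * ((L ^ kk : ℕ) : ℝ)) ^ 2 * ((((L ^ r : ℕ) : ℝ) + 1) * (((((L ^ r * L ^ kk : ℕ) : ℝ))⁻¹) * ((C / ξ) * Real.exp (((((L ^ r * L ^ kk : ℕ) : ℝ))⁻¹) * (C / ξ)))) * (((((L ^ r * L ^ kk : ℕ) : ℝ))⁻¹) ^ 2 * ((C / ξ ^ 2) * Real.exp (((((L ^ r * L ^ kk : ℕ) : ℝ))⁻¹) * (C / ξ)))))))) ≤ @basisConst ι _ (Matrix mm mm ℂ) Matrix.frobeniusNormedAddCommGroup Matrix.frobeniusNormedSpace e * Fintype.card mm * ((4 * Cβ * (ξ ^ (2 + β))⁻¹ * Real.exp (5 * (C / ξ))) + ((2 * ((d + 1 : ℕ) : ℝ) + 2) * ((C / ξ ^ 2) ^ 2 * Real.exp (2 * (C / ξ))) + 8 * ((C / ξ) * (C / ξ ^ 2) * Real.exp (2 * (C / ξ)))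 + 8 * ((C / ξ) * (C / ξ ^ 2) * Real.exp (5 * (C / ξ))))) * (((L : ℝ) ^ kk) ^ (-(1 / 4 : ℝ)) + (2 * ((((L ^ kk : ℕ) : ℝ))⁻¹)) ^ β) := by
    refine hoB.trans ?_
    have hκm : 0 ≤ @basisConst ι _ (Matrix mm mm ℂ) Matrix.frobeniusNormedAddCommGroup Matrix.frobeniusNormedSpace e * (Fintype.card mm : ℝ) := mul_nonneg hκ (Nat.cast_nonneg _)
    have ha : (2 * ((((L ^ kk : ℕ) : ℝ))⁻¹)) ^ β * (4 * Cβ * (ξ ^ (2 + β))⁻¹ * Real.exp (5 * (C / ξ))) ≤ (4 * Cβ * (ξ ^ (2 + β))⁻¹ * Real.exp (5 * (C / ξ))) * (((L : ℝ) ^ kk) ^ (-(1 / 4 : ℝ)) + (2 * ((((L ^ kk : ℕ) : ℝ))⁻¹)) ^ β) := by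
      rw [mul_comm]; exact mul_le_mul_of_nonneg_left (le_add_of_nonneg_left hx0) hR10
    have hb : ((((L ^ kk : ℕ) : ℝ))⁻¹) * ((2 * ((d + 1 : ℕ) : ℝ) + 2) * ((C / ξ ^ 2) ^ 2 * Real.exp (2 * (C / ξ))) + 8 * ((C / ξ) * (C / ξ ^ 2) * Real.exp (2 * (C / ξ))) + 8 * ((C / ξ) * (C / ξ ^ 2) * Real.exp (5 * (C / ξ)))) ≤ ((2 * ((d + 1 : ℕ) : ℝ) + 2) * ((C / ξ ^ 2) ^ 2 * Real.exp (2 * (C / ξ))) + 8 * ((C / ξ) * (C / ξ ^ 2) * Real.exp (2 * (C / ξ))) + 8 * ((C / ξ) * (C / ξ ^ 2) * Real.exp (5 * (C / ξ)))) * (((L : ℝ) ^ kk) ^ (-(1 / 4 : ℝ)) + (2 * ((((L ^ kk : ℕ) : ℝ))⁻¹)) ^ β) := by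
      rw [mul_comm]; exact mul_le_mul_of_nonneg_left (hηx.trans (le_add_of_nonneg_right hxβ0)) hR20
    calc @basisConst ι _ (Matrix mm mm ℂ) Matrix.frobeniusNormedAddCommGroup Matrix.frobeniusNormedSpace e * Fintype.card mm * ((2 * ((((L ^ kk : ℕ) : ℝ))⁻¹)) ^ β * (4 * Cβ * (ξ ^ (2 + β))⁻¹ * Real.exp (5 * (C / ξ))) + ((((L ^ kk : ℕ) : ℝ))⁻¹) * ((2 * ((d + 1 : ℕ) : ℝ) + 2) * ((C / ξ ^ 2) ^ 2 * Real.exp (2 * (C / ξ))) + 8 * ((C / ξ) * (C / ξ ^ 2) * Real.exp (2 * (C / ξ))) + 8 * ((C / ξ) * (C / ξ ^ 2) * Real.exp (5 * (C / ξ)))))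
        ≤ @basisConst ι _ (Matrix mm mm ℂ) Matrix.frobeniusNormedAddCommGroup Matrix.frobeniusNormedSpace e * Fintype.card mm * ((4 * Cβ * (ξ ^ (2 + β))⁻¹ * Real.exp (5 * (C / ξ))) * (((L : ℝ) ^ kk) ^ (-(1 / 4 : ℝ)) + (2 * ((((L ^ kk : ℕ) : ℝ))⁻¹)) ^ β) + ((2 * ((d + 1 : ℕ) : ℝ) + 2) * ((C / ξ ^ 2) ^ 2 * Real.exp (2 * (C / ξ))) + 8 * ((C / ξ) * (C / ξ ^ 2) * Real.exp (2 * (C / ξ))) + 8 * ((C / ξ) * (C / ξ ^ 2) * Real.exp (5 * (C / ξ)))) * (((L : ℝ) ^ kk) ^ (-(1 / 4 : ℝ)) + (2 * ((((L ^ kk : ℕ) : ℝ))⁻¹)) ^ β)) :=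
          mul_le_mul_of_nonneg_left (add_le_add ha hb) hκm
      _ = @basisConst ι _ (Matrix mm mm ℂ) Matrix.frobeniusNormedAddCommGroup Matrix.frobeniusNormedSpace e * Fintype.card mm * ((4 * Cβ * (ξ ^ (2 + β))⁻¹ * Real.exp (5 * (C / ξ))) + ((2 * ((d + 1 : ℕ) : ℝ) + 2) * ((C / ξ ^ 2) ^ 2 * Real.exp (2 * (C / ξ))) + 8 * ((C / ξ) * (C / ξ ^ 2) * Real.exp (2 * (C / ξ))) + 8 * ((C / ξ) * (C / ξ ^ 2) * Real.exp (5 * (C / ξ))))) * (((L : ℝ) ^ kk) ^ (-(1 / 4 : ℝ)) + (2 * ((((L ^ kk : ℕ) : ℝ))⁻¹)) ^ β) := by ring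
  have hD0 : 0 ≤ max D 0 := le_max_right _ _
  have hsum0 : (0 : ℝ) ≤ ((L : ℝ) ^ kk) ^ (-(1 / 4 : ℝ)) + (2 * ((((L ^ kk : ℕ) : ℝ))⁻¹)) ^ β := add_nonneg hx0 hxβ0
  calc D * (((L : ℝ) ^ kk) ^ (-(1 / 4 : ℝ)) + (@basisConst ι _ (Matrix mm mm ℂ) Matrix.frobeniusNormedAddCommGroup Matrix.frobeniusNormedSpace e * (((L ^ r * L ^ kk : ℕ) : ℝ) ^ 2 * (Fintype.card mm * (2 * (((((L ^ r * L ^ kk : ℕ) : ℝ))⁻¹) ^ 2 * ((Cβ * (ξ ^ (2 + β))⁻¹ * (2 * ((L ^ r : ℕ) : ℝ) * ((((L ^ r * L ^ kk : ℕ) : ℝ))⁻¹)) ^ β + 2 * ((((L ^ r * L ^ kk : ℕ) : ℝ))⁻¹) * ((C / ξ) * (C / ξ ^ 2))) * Real.exp (5 * (((((L ^ r * L ^ kk : ℕ) : ℝ))⁻¹) * (C / ξ))))) + ((((L ^ r * L ^ kk : ℕ) : ℝ))⁻¹) ^ 2 * ((C / ξ ^ 2) * Real.exp (((((L ^ r *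 L ^ kk : ℕ) : ℝ))⁻¹) * (C / ξ))) * (((d + 1 : ℕ) : ℝ) * (((L ^ r - 1 : ℕ) : ℝ) * (((((L ^ r * L ^ kk : ℕ) : ℝ))⁻¹) ^ 2 * ((C / ξ ^ 2) * Real.exp (((((L ^ r * L ^ kk : ℕ) : ℝ))⁻¹) * (C / ξ)))))) + (((((L ^ r * L ^ kk : ℕ) : ℝ))⁻¹) ^ 2 * ((C / ξ ^ 2) * Real.exp (((((L ^ r * L ^ kk : ℕ) : ℝ))⁻¹) * (C / ξ))) + (((d + 1 : ℕ) : ℝ) * (((L ^ r - 1 : ℕ) : ℝ) * (((((L ^ r * L ^ kk : ℕ) : ℝ))⁻¹) ^ 2 * ((C / ξ ^ 2) * Real.exp (((((L ^ r * L ^ kk : ℕ) : ℝ))⁻¹) * (C / ξ)))))) + ((((L ^ r * L ^ kk : ℕ) : ℝ))⁻¹) ^ 2 * ((C / ξ ^ 2) * Real.exp (((((L ^ r * L ^ kk : ℕ) : ℝ))⁻¹) * (C / ξ)))) * (((((L ^ r * L ^ kk : ℕ) : ℝ))⁻¹) ^ 2 * ((C / ξ ^ 2) * Real.exp (((((L ^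 r * L ^ kk : ℕ) : ℝ))⁻¹) * (C / ξ)))))) + Fintype.card mm * (2 * ((L ^ kk : ℕ) : ℝ) ^ 2 * (2 * ((L ^ r : ℕ) : ℝ) ^ 3 * ((((((L ^ r * L ^ kk : ℕ) : ℝ))⁻¹) * ((C / ξ) * Real.exp (((((L ^ r * L ^ kk : ℕ) : ℝ))⁻¹) * (C / ξ)))) * (((((L ^ r * L ^ kk : ℕ) : ℝ))⁻¹) ^ 2 * ((C / ξ ^ 2) * Real.exp (((((L ^ r * L ^ kk : ℕ) : ℝ))⁻¹) * (C / ξ))))) + ((L ^ r : ℕ) : ℝ) ^ 2 * (((((L ^ r * L ^ kk : ℕ) : ℝ))⁻¹) ^ 2 * ((Cβ * (ξ ^ (2 + β))⁻¹ * (2 * ((L ^ r : ℕ) : ℝ) * ((((L ^ r * L ^ kk : ℕ) : ℝ))⁻¹)) ^ β + 2 * ((((L ^ r * L ^ kk : ℕ) : ℝ))⁻¹) * ((C / ξ) * (C / ξ ^ 2))) * Real.exp (5 * (((((L ^ r * L ^ kk : ℕ) : ℝ))⁻¹) * (C / ξ)))))) + 2 * (((L ^ r : ℕ) : ℝ) *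 ((L ^ kk : ℕ) : ℝ)) ^ 2 * ((((L ^ r : ℕ) : ℝ) + 1) * (((((L ^ r * L ^ kk : ℕ) : ℝ))⁻¹) * ((C / ξ) * Real.exp (((((L ^ r * L ^ kk : ℕ) : ℝ))⁻¹) * (C / ξ)))) * (((((L ^ r * L ^ kk : ℕ) : ℝ))⁻¹) ^ 2 * ((C / ξ ^ 2) * Real.exp (((((L ^ r * L ^ kk : ℕ) : ℝ))⁻¹) * (C / ξ))))))))) * Real.exp (-(δ / 16 * (unitTorusGeo L kk (cvM d L mv kk hL)).dist y y'))
      ≤ max D 0 * (((L : ℝ) ^ kk) ^ (-(1 / 4 : ℝ)) + (@basisConst ι _ (Matrix mm mm ℂ) Matrix.frobeniusNormedAddCommGroup Matrix.frobeniusNormedSpace e * (((L ^ r * L ^ kk : ℕ) : ℝ) ^ 2 * (Fintype.card mm * (2 * (((((L ^ r * L ^ kk : ℕ) : ℝ))⁻¹) ^ 2 * ((Cβ * (ξ ^ (2 + β))⁻¹ * (2 * ((L ^ r : ℕ) : ℝ) * ((((L ^ r * L ^ kk : ℕ) : ℝ))⁻¹)) ^ β + 2 * ((((L ^ r * L ^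 kk : ℕ) : ℝ))⁻¹) * ((C / ξ) * (C / ξ ^ 2))) * Real.exp (5 * (((((L ^ r * L ^ kk : ℕ) : ℝ))⁻¹) * (C / ξ))))) + ((((L ^ r * L ^ kk : ℕ) : ℝ))⁻¹) ^ 2 * ((C / ξ ^ 2) * Real.exp (((((L ^ r * L ^ kk : ℕ) : ℝ))⁻¹) * (C / ξ))) * (((d + 1 : ℕ) : ℝ) * (((L ^ r - 1 : ℕ) : ℝ) * (((((L ^ r * L ^ kk : ℕ) : ℝ))⁻¹) ^ 2 * ((C / ξ ^ 2) * Real.exp (((((L ^ r * L ^ kk : ℕ) : ℝ))⁻¹) * (C / ξ)))))) + (((((L ^ r * L ^ kk : ℕ) : ℝ))⁻¹) ^ 2 * ((C / ξ ^ 2) * Real.exp (((((L ^ r * L ^ kk : ℕ) : ℝ))⁻¹) * (C / ξ))) + (((d + 1 : ℕ) : ℝ) * (((L ^ r - 1 : ℕ) : ℝ) * (((((L ^ r * L ^ kk : ℕ) : ℝ))⁻¹) ^ 2 * ((C / ξ ^ 2) * Real.exp (((((L ^ r * L ^ kk : ℕ) : ℝ))⁻¹) * (C / ξ)))))) + ((((L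 ^ r * L ^ kk : ℕ) : ℝ))⁻¹) ^ 2 * ((C / ξ ^ 2) * Real.exp (((((L ^ r * L ^ kk : ℕ) : ℝ))⁻¹) * (C / ξ)))) * (((((L ^ r * L ^ kk : ℕ) : ℝ))⁻¹) ^ 2 * ((C / ξ ^ 2) * Real.exp (((((L ^ r * L ^ kk : ℕ) : ℝ))⁻¹) * (C / ξ)))))) + Fintype.card mm * (2 * ((L ^ kk : ℕ) : ℝ) ^ 2 * (2 * ((L ^ r : ℕ) : ℝ) ^ 3 * ((((((L ^ r * L ^ kk : ℕ) : ℝ))⁻¹) * ((C / ξ) * Real.exp (((((L ^ r * L ^ kk : ℕ) : ℝ))⁻¹) * (C / ξ)))) * (((((L ^ r * L ^ kk : ℕ) : ℝ))⁻¹) ^ 2 * ((C / ξ ^ 2) * Real.exp (((((L ^ r * L ^ kk : ℕ) : ℝ))⁻¹) * (C / ξ))))) + ((L ^ r : ℕ) : ℝ) ^ 2 * (((((L ^ r * L ^ kk : ℕ) : ℝ))⁻¹) ^ 2 * ((Cβ * (ξ ^ (2 + β))⁻¹ * (2 * ((L ^ r : ℕ) : ℝ) * ((((L ^ r * L ^ kk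 : ℕ) : ℝ))⁻¹)) ^ β + 2 * ((((L ^ r * L ^ kk : ℕ) : ℝ))⁻¹) * ((C / ξ) * (C / ξ ^ 2))) * Real.exp (5 * (((((L ^ r * L ^ kk : ℕ) : ℝ))⁻¹) * (C / ξ)))))) + 2 * (((L ^ r : ℕ) : ℝ) * ((L ^ kk : ℕ) : ℝ)) ^ 2 * ((((L ^ r : ℕ) : ℝ) + 1) * (((((L ^ r * L ^ kk : ℕ) : ℝ))⁻¹) * ((C / ξ) * Real.exp (((((L ^ r * L ^ kk : ℕ) : ℝ))⁻¹) * (C / ξ)))) * (((((L ^ r * L ^ kk : ℕ) : ℝ))⁻¹) ^ 2 * ((C / ξ ^ 2) * Real.exp (((((L ^ r * L ^ kk : ℕ) : ℝ))⁻¹) * (C / ξ))))))))) * Real.exp (-(δ / 16 * (unitTorusGeo L kk (cvM d L mv kk hL)).dist y y')) :=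
        mul_le_mul_of_nonneg_right (mul_le_mul_of_nonneg_right (le_max_left _ _) (add_nonneg hx0 hoB0)) (Real.exp_pos _).le
    _ ≤ max D 0 * ((((L : ℝ) ^ kk) ^ (-(1 / 4 : ℝ)) + (2 * ((((L ^ kk : ℕ) : ℝ))⁻¹)) ^ β) + @basisConst ι _ (Matrix mm mm ℂ) Matrix.frobeniusNormedAddCommGroup Matrix.frobeniusNormedSpace e * Fintype.card mm * ((4 * Cβ * (ξ ^ (2 + β))⁻¹ * Real.exp (5 * (C / ξ))) + ((2 * ((d + 1 : ℕ) : ℝ) + 2) * ((C / ξ ^ 2) ^ 2 * Real.exp (2 * (C / ξ))) + 8 * ((C / ξ) * (C / ξ ^ 2) * Real.exp (2 * (C / ξ))) + 8 * ((C / ξ) * (C / ξ ^ 2) * Real.exp (5 * (C / ξ))))) * (((L : ℝ) ^ kk) ^ (-(1 / 4 : ℝ)) + (2 * ((((L ^ kk : ℕ) : ℝ))⁻¹)) ^ β)) * Real.exp (-(δ / 16 * (unitTorusGeo L kk (cvM d L mv kk hL)).dist y y')) :=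
        mul_le_mul_of_nonneg_right (mul_le_mul_of_nonneg_left (add_le_add (le_add_of_nonneg_right hxβ0) h2) hD0) (Real.exp_pos _).le
    _ = max D 0 * (1 + @basisConst ι _ (Matrix mm mm ℂ) Matrix.frobeniusNormedAddCommGroup Matrix.frobeniusNormedSpace e * Fintype.card mm * ((4 * Cβ * (ξ ^ (2 + β))⁻¹ * Real.exp (5 * (C / ξ))) + ((2 * ((d + 1 : ℕ) : ℝ) + 2) * ((C / ξ ^ 2) ^ 2 * Real.exp (2 * (C / ξ))) + 8 * ((C / ξ) * (C / ξ ^ 2) * Real.exp (2 * (C / ξ))) + 8 * ((C / ξ) * (C / ξ ^ 2) * Real.exp (5 * (C / ξ)))))) * (((L : ℝ) ^ kk) ^ (-(1 / 4 : ℝ)) + (2 * ((((L ^ kk : ℕ) : ℝ))⁻¹)) ^ β) * Real.exp (-(δ / 16 * (unitTorusGeo L kk (cvM d L mv kk hL)).dist y y')) := by ring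

/-! ## §3 On the printed class: [B11] Thm 1 (9)–(10) per cube AS TYPED -/

set_option maxHeartbeats 800000 in
/-- ★★★★ **THE (PC-E) RATE FOR THE GRADIENT ENTRY `D_U∘G′(U)` OF [B9] (3.42) FOR THE NAMED SCALAR COVARIANT GREEN's FUNCTIONS FROM THE PRINTED PER-CUBE CLASS [B11] Thm 1 (9)–(10)
AS TYPED** (dag-n07-a `B11Reg910Classes.Reg910Cube`, η′-scale distance, ANY `β₀ ≥ 0`): ONE datum per cube + ONE smallness condition ⟹ the two-grid η-defect through `τ_{Ad∘U′}` of
`D_{U′,μ₀} ∘ scGreenOp′ … U′` against `D_{U,μ₀} ∘ scGreenOp … U` (`scGreenOp = (Δ_{R_U} + aQ′_TᵀQ′_T)⁻¹`, `U` = the straight fine holonomies of `U′`) is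
`≤ D(1+κ_e|m|(R₁+R₂))·((L^k)^{−1∕4} + (2L^{−k})^{β₀})·e^{−(δ∕16)|y−y′|_T}` with the SAME constants for every `r` — NO existential over per-cube gauges. [cite: Balaban1985Variational, Thm 1 (9)–(10) p.279; Balaban1985BackgroundPropagators, (3.42) p.397, Thm 3.14 pp.426–427 (template), (3.24)–(3.25) p.394, (3.35)–(3.36) p.396, (3.51)–(3.52) p.400; King1986, p.664, Lemma 4.5 (4.38) p.674 (A = 0 template)] -/
theorem uN_idef_covD_scGreenOp_of_reg910_rate (hL : Odd L ∧ 1 < L) (hL7 : 7 ≤ L) {a₀ : ℝ} (ha₀ : 0 < a₀) (ι : Type) [Fintype ι] [DecidableEq ι] (μ₀ : Fin (d + 1)) :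
    ∃ δ w₀ c₀ D : ℝ, 0 < δ ∧ 0 < c₀ ∧ 0 ≤ D ∧ ∀ (mv kk r : ℕ), 1 ≤ kk → 1 ≤ r → w₀ ≤ ((L ^ mv : ℕ) : ℝ) →
      ∀ {mm : Type} [Fintype mm] [DecidableEq mm] [Nonempty mm] (e : Matrix mm mm ℂ ≃L[ℝ] (ι → ℝ)), (∀ A B : Matrix mm mm ℂ, traceForm A B = e A ⬝ᵥ e B) →
      ∀ (U' : Fin (d + 1) → ScX' d L mv kk r hL → (Matrix mm mm ℂ)ˣ), (∀ μ x', (U' μ x' : Matrix mm mm ℂ) ∈ Matrix.unitaryGroup mm ℂ) →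
      ∀ (Q : (Fin (d + 1) → ZMod (2 * L)) → Set (ScX' d L mv kk r hL)) (ξ C β₀ C₄ : ℝ), 0 < ξ → 0 ≤ C → 0 ≤ β₀ → 0 ≤ C₄ →
        (1 + @basisConst ι _ (Matrix mm mm ℂ) Matrix.frobeniusNormedAddCommGroup Matrix.frobeniusNormedSpace e * (2 * Real.sqrt (Fintype.card mm)) * Real.sqrt (Fintype.card mm)) ^ 2 * (C / ξ + C / ξ ^ 2) ≤ c₀ →
        -- [B11] Thm 1 (9)–(10) per cube AS TYPED (dag-n07-a), η′-scale fine torus distance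
        (∀ k, B11Reg910Classes.Reg910Cube (scShift' d L mv kk r hL) U' ((((L ^ r * L ^ kk : ℕ) : ℝ))⁻¹) (Q k) ξ (fun z z' => ((((L ^ r * L ^ kk : ℕ) : ℝ))⁻¹) * tdistT (fine (L ^ r * L ^ kk) (cvM d L mv kk hL)) z z') C C₄ β₀) →
        (∀ k z, (∃ y ∈ cvSk d L mv kk hL k, (unitTorusGeo L kk (cvM d L mv kk hL)).dist (scBlk' d L mv kk r hL z) y ≤ 5) → z ∈ Q k) →
        HasMaj (ScNorm d L mv kk hL ι) (BlockNorm.ofBlocks (unitTorusGeo L kk (cvM d L mv kk hL)) (liftBlk (scBlk d L mv kk hL ∘ kingPr L kk r (cvM d L mv kk hL)) ι))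
          (idef (ctauS (cvM d L mv kk hL) L kk r (fun μ x' => coordMat e (ContinuousLinearMap.mulLeftRight ℝ (Matrix mm mm ℂ) ((U' μ x' : Matrix mm mm ℂ)) ((U' μ x' : Matrix mm mm ℂ))ᴴ))) (ctauS (cvM d L mv kk hL) L kk r (fun μ x' => coordMat e (ContinuousLinearMap.mulLeftRight ℝ (Matrix mm mm ℂ) ((U' μ x' : Matrix mm mm ℂ)) ((U' μ x' : Matrix mm mm ℂ))ᴴ))) (covD ((((L ^ r * L ^ kk : ℕ) : ℝ))⁻¹) (fun x' => coordMat e (ContinuousLinearMap.mulLeftRight ℝ (Matrix mm mm ℂ) ((U' μ₀ x' : Matrix mm mm ℂ)) ((U' μ₀ x' : Matrix mm mm ℂ))ᴴ)) (scShift' d L mv kk r hL μ₀) ∘ₗ scGreenOp' d L mv kk r hL (aK a₀ (L : ℝ) (r + kk) * (((L ^ r * L ^ kk : ℕ) : ℝ)) ^ (d + 1)) ((((L ^ r * L ^ kk : ℕ) : ℝ))⁻¹) ι e (fun μ z => (U' μ z : Matrix mm mm ℂ))) (covD ((((L ^ kk : ℕ) : ℝ))⁻¹) (fun x => coordMat e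 (ContinuousLinearMap.mulLeftRight ℝ (Matrix mm mm ℂ) ((fun μ y => mprod (fun t => (U' μ (kingSec (cvM d L mv kk hL) L kk r y + t • unitVec (fine (L ^ r * L ^ kk) (cvM d L mv kk hL)) μ) : Matrix mm mm ℂ)) (L ^ r)) μ₀ x) ((fun μ y => mprod (fun t => (U' μ (kingSec (cvM d L mv kk hL) L kk r y + t • unitVec (fine (L ^ r * L ^ kk) (cvM d L mv kk hL)) μ) : Matrix mm mm ℂ)) (L ^ r)) μ₀ x)ᴴ)) (scShift d L mv kk hL μ₀) ∘ₗ scGreenOp d L mv kk hL (aK a₀ (L : ℝ) kk * (((L ^ kk : ℕ) : ℝ)) ^ (d + 1)) ((((L ^ kk : ℕ) : ℝ))⁻¹) ι e (fun μ y => mprod (fun t => (U' μ (kingSec (cvM d L mv kk hL) L kk r y + t • unitVec (fine (L ^ r * L ^ kk) (cvM d L mv kk hL)) μ) : Matrix mm mm ℂ)) (L ^ r))))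
          (fun y y' => D * (1 + @basisConst ι _ (Matrix mm mm ℂ) Matrix.frobeniusNormedAddCommGroup Matrix.frobeniusNormedSpace e * Fintype.card mm * ((4 * C₄ * (ξ ^ (2 + β₀))⁻¹ * Real.exp (5 * (C / ξ))) + ((2 * ((d + 1 : ℕ) : ℝ) + 2) * ((C / ξ ^ 2) ^ 2 * Real.exp (2 * (C / ξ))) + 8 * ((C / ξ) * (C / ξ ^ 2) * Real.exp (2 * (C / ξ))) + 8 * ((C / ξ) * (C / ξ ^ 2) * Real.exp (5 * (C / ξ)))))) * (((L : ℝ) ^ kk) ^ (-(1 / 4 : ℝ)) + (2 * ((((L ^ kk : ℕ) : ℝ))⁻¹)) ^ β₀) * Real.exp (-(δ / 16 * (unitTorusGeo L kk (cvM d L mv kk hL)).dist y y'))) := by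
  obtain ⟨δ, w₀, c₀, D, hδ, hc₀, hD, H⟩ := uN_idef_covD_scGreenOp_of_reg335Holder_rate (d := d) hL hL7 ha₀ ι μ₀
  refine ⟨δ, w₀, c₀, D, hδ, hc₀, hD, fun mv kk r hk hr hw₀ => ?_⟩
  intro mm _ _ _ e he U' hU'g Q ξ C β₀ C₄ hξ hC hβ₀ hC₄ hsmall h910 hQ
  exact H mv kk r hk hr hw₀ e he U' hU'g Q ξ C β₀ C₄ hξ hC hβ₀ hC₄ hsmall (fun k => (h910 k).reg335HolderCube (scShift' d L mv kk r hL) U' hβ₀ le_rfl) hQ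

end Rate

end Summit.QuantumFields.YangMills.BalabanUVNodes.N15.Gluing

end
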